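import Summits.QuantumFields.YangMills.Theorems.DiagonalMirrorRPRWilsonDiagonalModelLinkKernel
import Literature.Analysis.OperatorTheory.HeterogeneousCyclicPeeling

/-!
# Crux `WeakCouplingHypercubicLimitRP` (stmt-QuantumFields-27398) / aside `DiagonalMirrorRPR` (⟨10604⟩), door B, construction F1_diag —
# PAIRING LAYER, step P3c: OPEN BLOCKS of the link-kernel chain (half-block kernel `T`, its time reversal, the free block as iterated `𝔟`)

Helper file (`--supports stmt-QuantumFields-27398 --as helper`) of `hand-10604-wilsonDiagModel-3` (director-ym g23, R695/R701-ym, O4 WORD 30: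
step P3 of hand-1's ROADMAP-F1diag v4 §1⅞ / hand-2's addendum v5); it closes nothing by itself.

An OPEN BLOCK of the lifted chain is a string of `e + 2` lifted states `V = a ∷ Zv :: b` with its `e + 1` bond half layers `Y`, weighted by
`∏_j c(V_j, Y_j, V_{j+1})` (`c = linkKer ρ β M`, `…LinkKernel`) and dressed by an observable `Jb Y V`:
* `blockFun Jb a Z z` (the weight in the cut variables: `Z` the `e` interior SITES `(V_j, Y_{j-1})`, `z = (b, Y_e)` the next site) and
  `openBlock Jb a b = ∫∫ Jb Y V ∏_j c` (the DRESSED `(e+1)`-step kernel); `integral_integral_blockFun` identifies them (un-zip, Fubini, `snoc`);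
* `readR I` / `readL I` — the dressing by a depth-`(e+1)` insertion read forward `(Y_j, X_{j+1})_j` / reflected `(Θ Y_{e−j}, X_{e−j})_j`;
  ★ `openBlock_readL_eq_openBlock_readR`: `T_L(u, m) = T_R(m, u)` — time reversal of the half block is transposition (`Zv ↦ Zv ∘ rev`,
  `Y ↦ Θ ∘ Y ∘ rev`, `linkKer_reverse`), the kernel-level heart of reflection positivity by the transfer matrix;
* `openBlock_one_eq_iterate` — the undressed block is `(κ_𝔟^[e] 𝔟(·, b))(a)` (`integral_linkKer`, tree `integral_pathWeight_mul_kernel_last_eq_iterate`);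
* measurability / bounds of `blockFun`, and `integral_pi_succ_eq_integral_snoc` (Fubini along `Fin.snoc`).

HONEST FRAMING: bookkeeping only; `wilsonDiagonalModel` is NOT landed here; no letter is proved; D1, ⟨27398⟩, S6i, ⟨10604⟩ are OPEN; nothing here
bears on the summit; the Yang–Mills mass gap is NOT proved here or anywhere in the tree.  Four plumbing definitions (`blockFun`, `openBlock`,
`readR`, `readL`), no `Prop` definition, no instance, no notation.  Refs: Osterwalder–Seiler, Ann. Phys. 110 (1978) §2–3; Seiler, LNP 159 (1982) Ch. 2.
-/

set_option autoImplicit false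

noncomputable section

open scoped BigOperators ENNReal
open MeasureTheory Function Filter
open Literature.MathematicalPhysics.QuantumLattice Literature.MathematicalPhysics.QuantumFieldTheory
open Summit.QuantumFields.YangMills.Cruxes.DiagonalMirrorRPR.ParityBridgeColdTraces

namespace Summit.QuantumFields.YangMills.Cruxes.DiagonalMirrorRPR.SignTwistedDiagonalTrace.WilsonDiagonal

/-! ## §1 Fubini along `Fin.snoc`; reversal of a `cons/snoc` string -/

section Peel

variable {Y : Type*} [MeasurableSpace Y] {ν : Measure Y} [IsFiniteMeasure ν]

/-- **Fubini along `Fin.snoc`**: for a bounded measurable `Φ` on `M + 1` sites,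
`∫ Φ dν^{⊗(M+1)} = ∫ (∫ Φ(snoc ζ' y) dν^{⊗M}(ζ')) dν(y)` (Mathlib `measurePreserving_piFinSuccAbove` at the pivot `last M`). -/
theorem integral_pi_succ_eq_integral_snoc (M : ℕ) {Φ : (Fin (M + 1) → Y) → ℝ} (hΦ : Measurable Φ)
    {B : ℝ} (hΦb : ∀ ζ, ‖Φ ζ‖ ≤ B) :
    ∫ ζ, Φ ζ ∂(Measure.pi fun _ : Fin (M + 1) => ν) =
      ∫ y, ∫ ζ' : Fin M → Y, Φ (Fin.snoc ζ' y) ∂(Measure.pi fun _ => ν) ∂ν := by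
  set pi : Measure (Fin M → Y) := Measure.pi fun _ => ν with hpi
  have hmp := (measurePreserving_piFinSuccAbove (fun _ : Fin (M + 1) => ν) (Fin.last M)).symm
  have he : ∀ p : Y × (Fin M → Y),
      (MeasurableEquiv.piFinSuccAbove (fun _ : Fin (M + 1) => Y) (Fin.last M)).symm p = Fin.snoc p.2 p.1 := by
    intro p
    simp only [MeasurableEquiv.piFinSuccAbove_symm_apply, Fin.insertNthEquiv, Fin.insertNth_last', Equiv.coe_fn_mk]
  have h1 : ∫ ζ, Φ ζ ∂(Measure.pi fun _ : Fin (M + 1) => ν) = ∫ p, Φ (Fin.snoc p.2 p.1) ∂(ν.prod pi) := by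
    rw [← hmp.integral_comp']
    refine integral_congr_ae (Eventually.of_forall fun p => ?_)
    dsimp only
    rw [he]
  rw [h1]
  have hsm : Measurable fun p : Y × (Fin M → Y) => (Fin.snoc p.2 p.1 : Fin (M + 1) → Y) :=
    (Literature.Analysis.OperatorTheory.measurable_finSnoc M).comp (measurable_snd.prodMk measurable_fst)
  have hint : Integrable (fun p : Y × (Fin M → Y) => Φ (Fin.snoc p.2 p.1)) (ν.prod pi) :=
    Integrable.of_bound (hΦ.comp hsm).aestronglyMeasurable B (Eventually.of_forall fun p => hΦb _)
  rw [integral_prod _ hint]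

omit [MeasurableSpace Y] in
/-- Reversal of a `cons/snoc` string: `(a ∷ v :: b) (rev i) = (b ∷ (v ∘ rev) :: a) i`. -/
theorem cons_snoc_rev {r : ℕ} (a b : Y) (v : Fin r → Y) (i : Fin (r + 2)) :
    (Fin.cons a (Fin.snoc v b) : Fin (r + 2) → Y) (Fin.rev i) = (Fin.cons b (Fin.snoc (fun j => v (Fin.rev j)) a) : Fin (r + 2) → Y) i := by
  refine Fin.cases ?_ (fun i' => ?_) i
  · simp only [Fin.rev_zero, Fin.cons_zero]
    rw [show (Fin.last (r + 1) : Fin (r + 2)) = (Fin.last r).succ from rfl, Fin.cons_succ, Fin.snoc_last]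
  · simp only [Fin.cons_succ]
    refine Fin.lastCases ?_ (fun k => ?_) i'
    · simp only [Fin.snoc_last]
      rw [show Fin.rev (Fin.last r).succ = (0 : Fin (r + 2)) by ext; simp]
      simp only [Fin.cons_zero]
    · simp only [Fin.snoc_castSucc]
      rw [show Fin.rev (k.castSucc.succ : Fin (r + 2)) = (Fin.rev k).castSucc.succ by
        ext; simp [Fin.val_rev]; omega]
      rw [Fin.cons_succ, Fin.snoc_castSucc]

end Peel

/-! ## §2 The dressed open block and its kernel -/

section OpenBlock

variable {S : ℕ} [NeZero S] {G : Type} [Group G] {Nc : ℕ} (ρ : G →* Matrix (Fin Nc) (Fin Nc) ℂ)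
variable [TopologicalSpace G] [IsTopologicalGroup G] [CompactSpace G] [MeasurableSpace G] [BorelSpace G]

/-- **The dressed block weight in the cut variables.**  `a` the first lifted state, `Z : Fin e → (ℕ × HalfCfg) × HalfCfg` the next `e` sites of
the chain (lifted state, bond half layer INTO it), `z = (b, y)` the site after them; with `V = a ∷ (Z·₁) :: b` and `Y = (Z·₂) :: y`:
`blockFun Jb a Z z = Jb Y V · ∏_{j ≤ e} c(V_j, Y_j, V_{j+1})`. -/
def blockFun (β M : ℝ) {e : ℕ} (Jb : (Fin (e + 1) → HalfCfg S S G) → (Fin (e + 2) → ℕ × HalfCfg S S G) → ℝ)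
    (a : ℕ × HalfCfg S S G) (Z : Fin e → (ℕ × HalfCfg S S G) × HalfCfg S S G) (z : (ℕ × HalfCfg S S G) × HalfCfg S S G) : ℝ :=
  Jb (Fin.snoc (fun j => (Z j).2) z.2) (Fin.cons a (Fin.snoc (fun j => (Z j).1) z.1)) *
    ∏ j : Fin (e + 1), linkKer ρ β M ((Fin.cons a (Fin.snoc (fun j => (Z j).1) z.1) : Fin (e + 2) → ℕ × HalfCfg S S G) j.castSucc)
      ((Fin.snoc (fun j => (Z j).2) z.2 : Fin (e + 1) → HalfCfg S S G) j)
      ((Fin.cons a (Fin.snoc (fun j => (Z j).1) z.1) : Fin (e + 2) → ℕ × HalfCfg S S G) j.succ)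

/-- **The dressed open-block kernel** between the end states `a, b`:
`openBlock Jb a b = ∫ (∫ Jb Y (a ∷ Zv :: b) ∏_j c((a ∷ Zv :: b)_j, Y_j, (a ∷ Zv :: b)_{j+1}) dY) dZv` over `halfHaar^{⊗(e+1)}` and `μ̃^{⊗e}`. -/
def openBlock (β M : ℝ) {e : ℕ} (Jb : (Fin (e + 1) → HalfCfg S S G) → (Fin (e + 2) → ℕ × HalfCfg S S G) → ℝ)
    (a b : ℕ × HalfCfg S S G) : ℝ :=
  ∫ Zv : Fin e → ℕ × HalfCfg S S G, ∫ Y : Fin (e + 1) → HalfCfg S S G,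
    Jb Y (Fin.cons a (Fin.snoc Zv b)) *
      ∏ j : Fin (e + 1), linkKer ρ β M ((Fin.cons a (Fin.snoc Zv b) : Fin (e + 2) → ℕ × HalfCfg S S G) j.castSucc) (Y j)
        ((Fin.cons a (Fin.snoc Zv b) : Fin (e + 2) → ℕ × HalfCfg S S G) j.succ)
    ∂(Measure.pi fun _ => halfHaar S G) ∂(Measure.pi fun _ => tMeasure S G Nc β M)

/-- The forward dressing by a depth-`(e+1)` insertion: `I` reads `(Y_j, X_{j+1})_{j ≤ e}` (bond half layer and the in-slab half of the NEXT state). -/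
def readR {e : ℕ} (I : (Fin (e + 1) → HalfCfg S S G × HalfCfg S S G) → ℝ)
    (Y : Fin (e + 1) → HalfCfg S S G) (V : Fin (e + 2) → ℕ × HalfCfg S S G) : ℝ :=
  I fun j => (Y j, (V j.succ).2)

/-- The reflected dressing: `I` reads `(Θ Y_{e−j}, X_{e−j})_{j ≤ e}` (the mirrored observable, read backwards through `Θ`). -/
def readL {e : ℕ} (I : (Fin (e + 1) → HalfCfg S S G × HalfCfg S S G) → ℝ)
    (Y : Fin (e + 1) → HalfCfg S S G) (V : Fin (e + 2) → ℕ × HalfCfg S S G) : ℝ :=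
  I fun j => (thetaHalf (Y (Fin.rev j)), (V (Fin.rev j).castSucc).2)

end OpenBlock

/-! ## §3 Time reversal of the dressed half block is transposition -/

section Reverse

variable {S : ℕ} [NeZero S] {G : Type} [Group G] {Nc : ℕ} (ρ : G →* Matrix (Fin Nc) (Fin Nc) ℂ)
variable [TopologicalSpace G] [IsTopologicalGroup G] [CompactSpace G] [MeasurableSpace G] [BorelSpace G]

/-- ★ **`T_L(u, m) = T_R(m, u)`** — the dressed open block read REFLECTED from `u` to `m` equals the block read FORWARD from `m` to `u`:
substitute `Zv ↦ Zv ∘ rev` (relabelling, measure preserving), `Y ↦ Θ ∘ Y ∘ rev` (`Θ` preserves `halfHaar`), use `(u ∷ (Zv∘rev) :: m) = (m ∷ Zv :: u) ∘ rev`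
and the Θ-reversibility `c(V′, ΘY, V) = c(V, Y, V′)` of every link. -/
theorem openBlock_readL_eq_openBlock_readR {β : ℝ} (hβ : 0 ≤ β) (M : ℝ) {e : ℕ}
    (I : (Fin (e + 1) → HalfCfg S S G × HalfCfg S S G) → ℝ) (u m : ℕ × HalfCfg S S G) :
    openBlock (Nc := Nc) ρ β M (readL I) u m = openBlock (Nc := Nc) ρ β M (readR I) m u := by
  haveI := isFiniteMeasure_tMeasure (S := S) (G := G) (Nc := Nc) hβ M
  haveI : IsProbabilityMeasure (halfHaar S G) := by unfold halfHaar; infer_instance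
  unfold openBlock
  -- relabel the interior states by `rev`
  rw [← Literature.Analysis.OperatorTheory.integral_pi_comp_perm (ρ := tMeasure S G Nc β M) Fin.revPerm]
  refine integral_congr_ae (ae_of_all _ fun Zv => ?_)
  dsimp only
  -- relabel the bond half layers by `rev`, then twist each by `Θ`
  rw [← Literature.Analysis.OperatorTheory.integral_pi_comp_perm (ρ := halfHaar S G) Fin.revPerm]
  have hΘ : MeasurePreserving (fun (Y : Fin (e + 1) → HalfCfg S S G) (j : Fin (e + 1)) => thetaEquiv (Y j))
      (Measure.pi fun _ => halfHaar S G) (Measure.pi fun _ => halfHaar S G) :=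
    measurePreserving_pi _ _ fun _ => measurePreserving_thetaEquiv
  rw [← hΘ.integral_comp (MeasurableEquiv.piCongrRight fun _ : Fin (e + 1) =>
    (thetaEquiv : HalfCfg S S G ≃ᵐ HalfCfg S S G)).measurableEmbedding]
  refine integral_congr_ae (ae_of_all _ fun Y => ?_)
  dsimp only
  simp only [Fin.revPerm_apply, thetaEquiv_apply]
  -- the reversed string
  have hV : ∀ i : Fin (e + 2), (Fin.cons u (Fin.snoc (fun j => Zv (Fin.rev j)) m) : Fin (e + 2) → ℕ × HalfCfg S S G) i =
      (Fin.cons m (Fin.snoc Zv u) : Fin (e + 2) → ℕ × HalfCfg S S G) (Fin.rev i) := fun i => (cons_snoc_rev m u Zv i).symm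
  -- the dressings agree
  have hread : readL I (fun j => thetaHalf (Y (Fin.rev j))) (Fin.cons u (Fin.snoc (fun j => Zv (Fin.rev j)) m)) =
      readR I Y (Fin.cons m (Fin.snoc Zv u)) := by
    unfold readL readR
    congr 1
    funext j
    dsimp only
    rw [Fin.rev_rev, thetaHalf_thetaHalf, hV, Fin.rev_castSucc, Fin.rev_rev]
  rw [hread]
  congr 1
  -- the link products agree after re-indexing by `rev`
  rw [← Equiv.prod_comp Fin.revPerm (fun j => linkKer ρ β M
    ((Fin.cons m (Fin.snoc Zv u) : Fin (e + 2) → ℕ × HalfCfg S S G) j.castSucc) (Y j)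
    ((Fin.cons m (Fin.snoc Zv u) : Fin (e + 2) → ℕ × HalfCfg S S G) j.succ))]
  refine Finset.prod_congr rfl fun j _ => ?_
  simp only [Fin.revPerm_apply]
  rw [hV, hV, Fin.rev_castSucc, Fin.rev_succ, linkKer_reverse]

end Reverse

/-! ## §4 The undressed open block is the iterated reweighted kernel -/

section Free

variable {S : ℕ} [NeZero S] {G : Type} [Group G] {Nc : ℕ} (ρ : G →* Matrix (Fin Nc) (Fin Nc) ℂ)
variable [TopologicalSpace G] [IsTopologicalGroup G] [CompactSpace G] [MeasurableSpace G] [BorelSpace G]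
  [SecondCountableTopology G]

/-- **The undressed open block is `(κ_𝔟^[e] 𝔟(·, b))(a)`**: integrating the `e + 1` bond half layers turns every link kernel into `𝔟`
(`integral_linkKer`), and the remaining `e`-fold `μ̃`-integral of the `𝔟`-path weight from `a` to `b` is the iterated kernel
(tree `integral_pathWeight_mul_kernel_last_eq_iterate`). -/
theorem openBlock_one_eq_iterate (hρ : Continuous ρ) {β : ℝ} (hβ : 0 ≤ β) {M : ℝ}
    (hM : ∀ (Y : HalfCfg S S G) (j : Fin (featDim S Nc)), |bondVec ρ Y j| ≤ M) (e : ℕ) (a b : ℕ × HalfCfg S S G) :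
    openBlock (Nc := Nc) ρ β M (e := e) (fun _ _ => (1 : ℝ)) a b =
      (fun f : ℕ × HalfCfg S S G → ℝ => fun w => ∫ z, bKernel ρ β M w z * f z ∂(tMeasure S G Nc β M))^[e]
        (fun z => bKernel ρ β M z b) a := by
  haveI := isFiniteMeasure_tMeasure (S := S) (G := G) (Nc := Nc) hβ M
  haveI : IsProbabilityMeasure (halfHaar S G) := by unfold halfHaar; infer_instance
  obtain ⟨C, hC⟩ := exists_abs_bKernel_le (S := S) ρ hρ β hM
  unfold openBlock
  simp only [one_mul]
  have hstep : ∀ Zv : Fin e → ℕ × HalfCfg S S G,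
      ∫ Y : Fin (e + 1) → HalfCfg S S G, ∏ j : Fin (e + 1), linkKer ρ β M
          ((Fin.cons a (Fin.snoc Zv b) : Fin (e + 2) → ℕ × HalfCfg S S G) j.castSucc) (Y j)
          ((Fin.cons a (Fin.snoc Zv b) : Fin (e + 2) → ℕ × HalfCfg S S G) j.succ) ∂(Measure.pi fun _ => halfHaar S G) =
        (∏ i : Fin e, bKernel ρ β M ((Fin.cons a Zv : Fin (e + 1) → ℕ × HalfCfg S S G) i.castSucc) (Zv i)) *
          bKernel ρ β M ((Fin.cons a Zv : Fin (e + 1) → ℕ × HalfCfg S S G) (Fin.last e)) b := by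
    intro Zv
    rw [integral_fintype_prod_eq_prod (ι := Fin (e + 1))
      (f := fun j y => linkKer ρ β M ((Fin.cons a (Fin.snoc Zv b) : Fin (e + 2) → ℕ × HalfCfg S S G) j.castSucc) y
        ((Fin.cons a (Fin.snoc Zv b) : Fin (e + 2) → ℕ × HalfCfg S S G) j.succ))]
    simp only [integral_linkKer]
    rw [Fin.prod_univ_castSucc, Fin.cons_snoc_eq_snoc_cons]
    congr 1
    · refine Finset.prod_congr rfl fun i _ => ?_
      rw [Fin.snoc_castSucc, Fin.succ_castSucc, Fin.snoc_castSucc, Fin.cons_succ]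
    · rw [Fin.snoc_castSucc, Fin.succ_last, Fin.snoc_last]
  simp_rw [hstep]
  exact Literature.Analysis.OperatorTheory.integral_pathWeight_mul_kernel_last_eq_iterate
    (stronglyMeasurable_bKernel ρ hρ β M).measurable hC b e a

end Free

/-! ## §5 The cut variables: un-zipping the interior sites -/

section Unzip

variable {S : ℕ} [NeZero S] {G : Type} [Group G] {Nc : ℕ} (ρ : G →* Matrix (Fin Nc) (Fin Nc) ℂ)
variable [TopologicalSpace G] [IsTopologicalGroup G] [CompactSpace G] [MeasurableSpace G] [BorelSpace G]
  [SecondCountableTopology G]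

omit [CompactSpace G] in
/-- Measurability of the dressed block integrand `x ↦ Jb (Y x) (V x) ∏_j c((V x)_j, (Y x)_j, (V x)_{j+1})` along measurable string-valued maps. -/
theorem measurable_blockIntegrand (hρ : Continuous ρ) (β M : ℝ) {e : ℕ}
    {Jb : (Fin (e + 1) → HalfCfg S S G) → (Fin (e + 2) → ℕ × HalfCfg S S G) → ℝ} (hJb : Measurable (uncurry Jb))
    {α : Type*} [MeasurableSpace α] {Yf : α → Fin (e + 1) → HalfCfg S S G} {Vf : α → Fin (e + 2) → ℕ × HalfCfg S S G}
    (hY : Measurable Yf) (hV : Measurable Vf) :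
    Measurable fun x => Jb (Yf x) (Vf x) * ∏ j : Fin (e + 1), linkKer ρ β M (Vf x j.castSucc) (Yf x j) (Vf x j.succ) := by
  have hj : ∀ j : Fin (e + 1), Measurable fun x => linkKer ρ β M (Vf x j.castSucc) (Yf x j) (Vf x j.succ) := by
    intro j
    have h1 : Measurable fun x => Vf x j.castSucc :=
      (measurable_pi_apply (X := fun _ : Fin (e + 2) => ℕ × HalfCfg S S G) j.castSucc).comp hV
    have h2 : Measurable fun x => Yf x j := (measurable_pi_apply (X := fun _ : Fin (e + 1) => HalfCfg S S G) j).comp hY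
    have h3 : Measurable fun x => Vf x j.succ :=
      (measurable_pi_apply (X := fun _ : Fin (e + 2) => ℕ × HalfCfg S S G) j.succ).comp hV
    have h := (measurable_linkKer ρ hρ β M).comp (h1.prodMk (h2.prodMk h3))
    exact h
  have hJ : Measurable fun x => Jb (Yf x) (Vf x) := by
    have h := hJb.comp (hY.prodMk hV)
    exact h
  exact hJ.mul (Finset.measurable_prod _ fun j _ => hj j)

omit [CompactSpace G] in
/-- The dressed block weight is jointly measurable in `(a, Z, z)` for a measurable dressing. -/
theorem measurable_blockFun (hρ : Continuous ρ) (β M : ℝ) {e : ℕ}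
    {Jb : (Fin (e + 1) → HalfCfg S S G) → (Fin (e + 2) → ℕ × HalfCfg S S G) → ℝ} (hJb : Measurable (uncurry Jb)) :
    Measurable fun p : (ℕ × HalfCfg S S G) × (Fin e → (ℕ × HalfCfg S S G) × HalfCfg S S G) × ((ℕ × HalfCfg S S G) × HalfCfg S S G) =>
      blockFun ρ β M Jb p.1 p.2.1 p.2.2 := by
  -- the two strings as measurable functions of `p`
  have hZ : ∀ j : Fin e, Measurable fun p : (ℕ × HalfCfg S S G) × (Fin e → (ℕ × HalfCfg S S G) × HalfCfg S S G) ×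
      ((ℕ × HalfCfg S S G) × HalfCfg S S G) => p.2.1 j := fun j => (measurable_pi_apply (X := fun _ : Fin e => (ℕ × HalfCfg S S G) × HalfCfg S S G) j).comp measurable_snd.fst
  have hY : Measurable fun p : (ℕ × HalfCfg S S G) × (Fin e → (ℕ × HalfCfg S S G) × HalfCfg S S G) ×
      ((ℕ × HalfCfg S S G) × HalfCfg S S G) => (Fin.snoc (fun j => (p.2.1 j).2) p.2.2.2 : Fin (e + 1) → HalfCfg S S G) :=
    (Literature.Analysis.OperatorTheory.measurable_finSnoc e).comp
      ((measurable_pi_lambda _ fun j => (hZ j).snd).prodMk measurable_snd.snd.snd)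
  have hV : Measurable fun p : (ℕ × HalfCfg S S G) × (Fin e → (ℕ × HalfCfg S S G) × HalfCfg S S G) ×
      ((ℕ × HalfCfg S S G) × HalfCfg S S G) =>
      (Fin.cons p.1 (Fin.snoc (fun j => (p.2.1 j).1) p.2.2.1) : Fin (e + 2) → ℕ × HalfCfg S S G) :=
    (Literature.Analysis.OperatorTheory.measurable_finCons (e + 1)).comp (measurable_fst.prodMk
      ((Literature.Analysis.OperatorTheory.measurable_finSnoc e).comp
        ((measurable_pi_lambda _ fun j => (hZ j).fst).prodMk measurable_snd.snd.fst)))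
  have h := measurable_blockIntegrand ρ hρ β M hJb hY hV
  unfold blockFun
  exact h

omit [TopologicalSpace G] [IsTopologicalGroup G] [CompactSpace G] [MeasurableSpace G] [BorelSpace G] [SecondCountableTopology G] in
/-- The dressed block weight is bounded by `B · C^{e+1}`. -/
theorem abs_blockFun_le {β M : ℝ} {e : ℕ} {Jb : (Fin (e + 1) → HalfCfg S S G) → (Fin (e + 2) → ℕ × HalfCfg S S G) → ℝ}
    {B : ℝ} (hB : ∀ Y V, |Jb Y V| ≤ B) {C : ℝ}
    (hC : ∀ (v : ℕ × HalfCfg S S G) (Y : HalfCfg S S G) (v' : ℕ × HalfCfg S S G), |linkKer ρ β M v Y v'| ≤ C)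
    (a : ℕ × HalfCfg S S G) (Z : Fin e → (ℕ × HalfCfg S S G) × HalfCfg S S G) (z : (ℕ × HalfCfg S S G) × HalfCfg S S G) :
    |blockFun ρ β M Jb a Z z| ≤ B * C ^ (e + 1) := by
  have hB0 : 0 ≤ B := (abs_nonneg _).trans (hB (fun _ _ => 1) fun _ => (0, fun _ => 1))
  unfold blockFun
  rw [abs_mul, Finset.abs_prod]
  refine mul_le_mul (hB _ _) ?_ (Finset.prod_nonneg fun _ _ => abs_nonneg _) hB0
  calc ∏ j : Fin (e + 1), |linkKer ρ β M _ _ _| ≤ ∏ _j : Fin (e + 1), C := Finset.prod_le_prod (fun _ _ => abs_nonneg _) fun _ _ => hC _ _ _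
    _ = C ^ (e + 1) := by rw [Finset.prod_const, Finset.card_univ, Fintype.card_fin]

/-- **The cut variables integrate to the open-block kernel**: `∫ (∫ blockFun Jb a Z (b, y) dZ) dy = openBlock Jb a b`
(un-zip `Z = (Zv, Zy)` by `measurePreserving_arrowProdEquivProdArrow`, Fubini, and `Fin.snoc Zy y` exhausts `halfHaar^{⊗(e+1)}`). -/
theorem integral_integral_blockFun (hρ : Continuous ρ) {β : ℝ} (hβ : 0 ≤ β) {M : ℝ}
    (hM : ∀ (Y : HalfCfg S S G) (j : Fin (featDim S Nc)), |bondVec ρ Y j| ≤ M) {e : ℕ}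
    {Jb : (Fin (e + 1) → HalfCfg S S G) → (Fin (e + 2) → ℕ × HalfCfg S S G) → ℝ} (hJb : Measurable (uncurry Jb))
    {B : ℝ} (hB : ∀ Y V, |Jb Y V| ≤ B) (a b : ℕ × HalfCfg S S G) :
    ∫ y, ∫ Z : Fin e → (ℕ × HalfCfg S S G) × HalfCfg S S G, blockFun ρ β M Jb a Z (b, y)
        ∂(Measure.pi fun _ => (tMeasure S G Nc β M).prod (halfHaar S G)) ∂(halfHaar S G) =
      openBlock (Nc := Nc) ρ β M Jb a b := by
  haveI : IsProbabilityMeasure (halfHaar S G) := by unfold halfHaar; infer_instance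
  haveI := isFiniteMeasure_tMeasure (S := S) (G := G) (Nc := Nc) hβ M
  obtain ⟨C, _, hC⟩ := exists_abs_linkKer_le (S := S) ρ hρ β hM
  set μ : Measure (ℕ × HalfCfg S S G) := tMeasure S G Nc β M with hμ
  set η : Measure (HalfCfg S S G) := halfHaar S G with hη
  -- the integrand in the un-zipped variables `(Zv, Y)`
  set Φ : (Fin e → ℕ × HalfCfg S S G) → (Fin (e + 1) → HalfCfg S S G) → ℝ := fun Zv Yf =>
    Jb Yf (Fin.cons a (Fin.snoc Zv b)) *
      ∏ j : Fin (e + 1), linkKer ρ β M ((Fin.cons a (Fin.snoc Zv b) : Fin (e + 2) → ℕ × HalfCfg S S G) j.castSucc) (Yf j)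
        ((Fin.cons a (Fin.snoc Zv b) : Fin (e + 2) → ℕ × HalfCfg S S G) j.succ) with hΦ
  have hbf : ∀ (Z : Fin e → (ℕ × HalfCfg S S G) × HalfCfg S S G) (y : HalfCfg S S G),
      blockFun ρ β M Jb a Z (b, y) = Φ (fun j => (Z j).1) (Fin.snoc (fun j => (Z j).2) y) := fun Z y => rfl
  -- measurability and bound of `Φ`
  have hΦm : Measurable (uncurry Φ) := by
    have hV : Measurable fun p : (Fin e → ℕ × HalfCfg S S G) × (Fin (e + 1) → HalfCfg S S G) =>
        (Fin.cons a (Fin.snoc p.1 b) : Fin (e + 2) → ℕ × HalfCfg S S G) :=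
      (Literature.Analysis.OperatorTheory.measurable_finCons (e + 1)).comp (measurable_const.prodMk
        ((Literature.Analysis.OperatorTheory.measurable_finSnoc e).comp (measurable_fst.prodMk measurable_const)))
    have h := measurable_blockIntegrand ρ hρ β M hJb measurable_snd hV
    exact h
  have hΦb : ∀ Zv Yf, |Φ Zv Yf| ≤ B * C ^ (e + 1) := fun Zv Yf => by
    have h := abs_blockFun_le ρ hB hC a (fun j => (Zv j, Yf j.castSucc)) (b, Yf (Fin.last e))
    rw [hbf] at h
    have hY : (Fin.snoc (fun j : Fin e => Yf j.castSucc) (Yf (Fin.last e)) : Fin (e + 1) → HalfCfg S S G) = Yf :=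
      Fin.snoc_init_self Yf
    dsimp only at h
    rwa [hY] at h
  -- un-zip `Z`
  have hmp := measurePreserving_arrowProdEquivProdArrow (ℕ × HalfCfg S S G) (HalfCfg S S G) (Fin e) (fun _ => μ) (fun _ => η)
  have hinner : ∀ y, ∫ Z : Fin e → (ℕ × HalfCfg S S G) × HalfCfg S S G, blockFun ρ β M Jb a Z (b, y)
        ∂(Measure.pi fun _ => μ.prod η) =
      ∫ Zv : Fin e → ℕ × HalfCfg S S G, ∫ Zy : Fin e → HalfCfg S S G, Φ Zv (Fin.snoc Zy y) ∂(Measure.pi fun _ => η)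
        ∂(Measure.pi fun _ => μ) := by
    intro y
    have h1 : ∫ Z : Fin e → (ℕ × HalfCfg S S G) × HalfCfg S S G, blockFun ρ β M Jb a Z (b, y) ∂(Measure.pi fun _ => μ.prod η) =
        ∫ q : (Fin e → ℕ × HalfCfg S S G) × (Fin e → HalfCfg S S G), Φ q.1 (Fin.snoc q.2 y)
          ∂((Measure.pi fun _ => μ).prod (Measure.pi fun _ => η)) := by
      rw [← (hmp.symm _).integral_comp' (f := (MeasurableEquiv.arrowProdEquivProdArrow _ _ (Fin e)).symm)]
      rfl
    rw [h1]
    have hm : Measurable fun q : (Fin e → ℕ × HalfCfg S S G) × (Fin e → HalfCfg S S G) => Φ q.1 (Fin.snoc q.2 y) :=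
      hΦm.comp (measurable_fst.prodMk ((Literature.Analysis.OperatorTheory.measurable_finSnoc e).comp
        (measurable_snd.prodMk measurable_const)))
    exact integral_prod _ (Integrable.of_bound hm.aestronglyMeasurable (B * C ^ (e + 1))
      (ae_of_all _ fun q => by simpa only [Real.norm_eq_abs] using hΦb _ _))
  simp_rw [hinner]
  -- swap `y` inside and re-zip `(Zy, y) ↦ Y`
  have hm2 : Measurable fun q : HalfCfg S S G × (Fin e → ℕ × HalfCfg S S G) =>
      ∫ Zy : Fin e → HalfCfg S S G, Φ q.2 (Fin.snoc Zy q.1) ∂(Measure.pi fun _ => η) := by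
    have h3 : Measurable fun r : (HalfCfg S S G × (Fin e → ℕ × HalfCfg S S G)) × (Fin e → HalfCfg S S G) =>
        Φ r.1.2 (Fin.snoc r.2 r.1.1) :=
      hΦm.comp (measurable_fst.snd.prodMk ((Literature.Analysis.OperatorTheory.measurable_finSnoc e).comp
        (measurable_snd.prodMk measurable_fst.fst)))
    exact (h3.stronglyMeasurable.integral_prod_right' (ν := Measure.pi fun _ => η)).measurable
  have hb2 : ∀ q : HalfCfg S S G × (Fin e → ℕ × HalfCfg S S G),
      ‖∫ Zy : Fin e → HalfCfg S S G, Φ q.2 (Fin.snoc Zy q.1) ∂(Measure.pi fun _ => η)‖ ≤ B * C ^ (e + 1) * 1 := fun q => by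
    haveI : IsProbabilityMeasure (Measure.pi fun _ : Fin e => η) := by infer_instance
    have h := norm_integral_le_of_norm_le_const (μ := Measure.pi fun _ : Fin e => η)
      (f := fun Zy : Fin e → HalfCfg S S G => Φ q.2 (Fin.snoc Zy q.1)) (C := B * C ^ (e + 1))
      (ae_of_all _ fun Zy => by simpa only [Real.norm_eq_abs] using hΦb _ _)
    simpa only [probReal_univ] using h
  rw [integral_integral_swap (Integrable.of_bound hm2.aestronglyMeasurable (B * C ^ (e + 1) * 1) (ae_of_all _ fun q => hb2 q))]
  unfold openBlock
  refine integral_congr_ae (ae_of_all _ fun Zv => ?_)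
  dsimp only
  rw [integral_pi_succ_eq_integral_snoc (ν := η) e (Φ := Φ Zv) (hΦm.comp (measurable_const.prodMk measurable_id))
    (B := B * C ^ (e + 1)) (fun Yf => by simpa only [Real.norm_eq_abs] using hΦb _ _)]

end Unzip

end Summit.QuantumFields.YangMills.Cruxes.DiagonalMirrorRPR.SignTwistedDiagonalTrace.WilsonDiagonal

end
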